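import Summits.Ventures.QEC.Census.CertCoverBatch
import Summits.Ventures.QEC.Census.BB.S8_126_w6_k12_01061B01.CoreDefs
import HarnessLib

set_option Elab.async false
set_option maxRecDepth 200000

/-!
# `[[252,12,16]]` one-level cover certificate of `S8_126_w6_k12_01061B01` — LEVEL-1→0 coset problems 54…67 (deep problems [0] excluded: `ProbDeep*.lean`) as COMPACT data
(`ProbData`: U, f, σ, y₀, allow; qec-type-10 `CertCoverBatch.mkCoset` rebuilds each `CosetProb` in the kernel) + their verdict
`probsOK cov covR hx hx1 D1 lxd 14` (one `decide +kernel`; 14 problems, depths f=0:10 f=1:3 f=2:1 f=3:0, est. 99.0 s).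
qec-search-1 g5 (pattern of search-9 g5 `Probs*`); data from JSON `level10.problems` (sha256 75f002ace624d82a…). Data + decided check; KERNEL.
-/

namespace Summit.Ventures.QEC.Census.S8_126_w6_k12_01061B01

open Matrix Summit.Ventures.QEC.Census Literature.InformationTheory.QuantumCodes

/-- Problems 54…67 (14): `⟨U, f, σ, y₀, allow⟩`. -/
def probs05 : List ProbData := [
    ⟨1584872782529149219486759388161, 1, 1154047817115766788, 317222172846963480213910978561, [0]⟩,
    ⟨1585066172881356823097453315585, 0, 1152923016703776772, 317260820694259285390335672833, [0]⟩,
    ⟨3169745517824257316460727108610, 1, 1154047404815683592, 2535301238236543587730052874240, [0]⟩,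
    ⟨3170132449644399975510761799682, 0, 1156301403619065864, 634521726398032790912170459138, [0]⟩,
    ⟨6339490988414473510408662549508, 1, 1154048229482958864, 1268888578047599566645704523780, [0]⟩,
    ⟨10778124999272204485715900236810, 0, 1154048504461529128, 10775649081413548940704299877378, [0]⟩,
    ⟨12677125623998905649055592883208, 0, 1172080769733005344, 2535301238236561601853718003720, [0]⟩,
    ⟨12678981929594905897754777617416, 2, 1154048779305881632, 10141204811279791549749770847232, [0, 274877906944]⟩,
    ⟨12678982042973206661891620869128, 0, 5770237298922770464, 10141204962400130688696356701184, [0]⟩,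
    ⟨12678984952499750762278606144512, 0, 1154066388672057344, 10141207229131430796600306304000, [0]⟩,
    ⟨12679030277182957798657453196424, 0, 1154329979408880160, 2537815803941342297613574078472, [0]⟩,
    ⟨12679175319947113501365479933448, 0, 1152921779904190496, 2537815766162410153181439853064, [0]⟩,
    ⟨12679368861415048556804829085704, 0, 1156302778176372768, 2538086603324937944873545236488, [0]⟩,
    ⟨12680529656875476533954916389896, 0, 1163064774519443488, 2538086905556390596730991677448, [0]⟩]

set_option maxHeartbeats 400000000 in
/-- Every problem of this chunk passes (`mkCoset` elimination + `cosetOKD` + fast `σ` + depth + `BU`-evenness + label checks). -/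
theorem probs05_ok : probsOK S8_126_w6_k12_01061B01.cov covR hx hx1 D1 lxd 14 probs05 = true := by
  decide +kernel

/-- Pointwise form. -/
theorem probs05_all : ∀ x ∈ S8_126_w6_k12_01061B01.probs05, probOK cov covR hx hx1 D1 lxd 14 x = true := by
  have h := probs05_ok
  rwa [probsOK, List.all_eq_true] at h

end Summit.Ventures.QEC.Census.S8_126_w6_k12_01061B01
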